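import Summits.CriticalPhenomena.CardyFormulaZ2.Theorems.CardyDualCurrentMartingaleToSLE6StubPercFaceBoxTight
import Summits.CriticalPhenomena.CardyFormulaZ2.Theorems.CardyUniqueLimitCardyRigidityFaceHalfPlaneG2OfTransfer
import Literature.Probability.RandomPlanarGeometry.LoewnerTransformContinuity
import Literature.Probability.RandomPlanarGeometry.DrivingFunctionMeasurable
import Literature.Probability.RandomPlanarGeometry.SLEExistenceConverse
import Literature.Probability.Percolation.BondInterfaceMeasurability
import HarnessLib

/-!
# Stub `stub_percFaceBoxTight` (crux stmt-CriticalPhenomena-11395, line `registered`), II: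
# per-scale box tightness is exactly Loewner describability of the raw polyline

Route `CardyDualCurrent`, crux `…Theses.CardyDualCurrent.MartingaleToSLE6`, stub S1
`stub_percFaceBoxTight : PercFaceBoxTight` (Kemppainen–Smirnov box tightness of the raw medial
exploration polyline `bondInterfaceIn D (Λ δ_k)` read through chordal maps of the oriented face
domains; shared verbatim with stmt-CriticalPhenomena-11389 and with STUB A1 of the sibling crux
`CardyRigidity`, stmt-CriticalPhenomena-0746). Sequel of
`Theorems/CardyDualCurrentMartingaleToSLE6StubPercFaceBoxTight.lean` (p152755), which reduced the
stub to (i) the named fact `exists_regularity_of_conditionG2` (KS17 §3, simple curves), (ii) a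
simple measurable modification `γm` of the polyline with ONE Condition G2, (iii) an eventual
transfer of box membership `γm → bondInterfaceIn`, (iv) per-scale box tightness `hfin` of the raw
interface at each fixed positive admissible mesh.

## What this file proves (sorry-free): (iv) is discharged down to its deterministic core

At a FIXED mesh the interface takes countably many values (`countable_range_of_medialExploration`),
one Loewner pair lies in SOME box (moduli of continuity on each `[0, k + 1]`, a transience
profile), finitely many boxes lie in one box (`pairBox_mono`, `exists_box_forall_of_eventually`),
and countably many events exhaust a finite measure. Hence:

* `boxTight_of_ae_isLoewnerDescribable` — for a finite measure `μ`, a countable-range measurable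
  `X : Ω → CurveClass ℂ` with values from `a`, and a chordal `ψ` of `(D; a, b)`: if `μ`-a.e. `X ω`
  is Loewner describable through `ψ` (`IsLoewnerDescribable`), then for every `ε > 0` ONE box
  `(δγ, δW, T)` has `μ (X ∉ ⟦Ψ ∘ pr₁⟧ '' box) ≤ ε`; `ae_isLoewnerDescribable_of_boxTight` is the
  converse (box pairs are transient Loewner pairs, `isLoewnerDescribed_compactifiedClass`), so the
  two are EQUIVALENT;
* `percBoxTightFixedMesh_of_ae_isLoewnerDescribable` — the hypothesis `hfin` of p152755, verbatim,
  from (iv′): at every positive admissible mesh, through every chordal `ψ` of the oriented face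
  domain, `Pc`-a.e. `IsLoewnerDescribable ψ (bondInterfaceIn D (Λ δ) ω)`;
* `percFaceBoxTight_of_conditionG2_of_describable` — **`PercFaceBoxTight` from (i), (ii), (iii)
  and (iv′)** (p152755 with `hfin` replaced by the box-free hypothesis `hdesc`);
* `ae_isLoewnerDescribable_of_percFaceBoxTight` — conversely `PercFaceBoxTight` forces (iv′) along
  every system of chordal maps with (U1), (U2): raw describability is NECESSARY for the stub.

## What remains (exact Lean shapes = the hypotheses of the last reduction; none is in the tree)

(i) `hKS` = `Literature.Probability.RandomPlanarGeometry.exists_regularity_of_conditionG2` (KS17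
Prop. 3.2, 3.8, Thms. 3.9–3.10, §3.5; named fact, unproved); (ii) `γm`, `hmeas`, `hsupp`, `hG2`
(KS17 §4.1.2–4.1.4 square–octagon modification; Prop. 4.3 / 4.7, Condition G2 from RSW — the
sibling line `crossing_martingale` is landing the probabilistic half, p158102); (iii) `htr`
(driver stability); (iv′) `hdesc`: Loewner describability, through a chordal map of a polygonal
Jordan domain, of a NON-simple, boundary-touching, non-self-crossing lattice polyline — Lawler's
Prop. 4.4 beyond simple curves. The tree produces `IsLoewnerDescribable` only for SIMPLE curves
with `c(0,1) ⊆ D` (`isLoewnerDescribable_mk_of_injOn`, `exists_isLoewnerDescribed_of_segment`) and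
for limits of simple curves with converging drivers (`LoewnerCurveLimitDomain.lean`); the raw
exploration polyline of `ℤ²` touches `∂D_k` at midpoints of boundary edges and itself at doubly
visited medial vertices (KS17 §1.1: `X_0 ⊋ X_simple`; §4.1.4), so neither applies. Since (iii)
eventually and (iv′) at every scale both say that the raw polyline is `⟦Φ_k ∘ γ̂⟧` for a Loewner
pair, (iv′) is the deterministic core of what S1 asks beyond Kemppainen–Smirnov's own theorem
(stated for the simple modified curve only).

References: A. Kemppainen, S. Smirnov, Ann. Probab. 45 (2017) 698–779 (arXiv:1212.6215), §1.1,
§1.2, §3.5, §4.1.2–4.1.4, Prop. 4.3, Prop. 4.7, Remark 4.8 [KemppainenSmirnov2017]; G. F. Lawler,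
*Conformally Invariant Processes in the Plane* (2005), §4.1 Prop. 4.4 [Lawler2005].
-/

noncomputable section
open scoped Topology NNReal ENNReal unitInterval
open Filter Set MeasureTheory Metric
open UpperHalfPlane (upperHalfPlaneSet)
open Literature.Probability Literature.Probability.LatticeModels Literature.Probability.Percolation
open Literature.Probability.RandomPlanarGeometry
open scoped Literature.Probability.RandomPlanarGeometry.PathBorel

namespace Summit.CriticalPhenomena.CardyFormulaZ2.Cruxes.MartingaleToSLE6.Birth

open Summit.CriticalPhenomena.CardyFormulaZ2.Cruxes.ParafermionToSLESixFamilies.CaratheodoryNetSlitUniformity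
  (Pc PercFaceBoxTight)
open Summit.CriticalPhenomena.CardyFormulaZ2.Cruxes.CardyRigidity.CrossingMartingale.Driver
  (countable_range_of_medialExploration)
export Literature.Probability.Percolation (bondInterfaceIn bondInterfaceIn_apply)  -- buildfix 2026-08-20: alias to the OLD home (names ambiguous since the Literature migration); no declaration changes

/-! ### A single path lies in a box -/

/-- **Every continuous path has a modulus of continuity on each `[0, k + 1]`** (uniform continuity
on compacts), in the graded form of `Process.modulusSet`. [folklore] -/
theorem exists_modulus_of_continuousMap {E : Type*} [PseudoMetricSpace E] (x : C(ℝ≥0, E)) :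
    ∃ δ : ℕ → ℝ, (∀ k, 0 < δ k) ∧ ∀ (k : ℕ) (s t : ℝ≥0), (s : ℝ) ≤ k + 1 → (t : ℝ) ≤ k + 1 →
      dist s t ≤ δ k → dist (x s) (x t) ≤ 1 / ((k : ℝ) + 1) := by
  have key : ∀ k : ℕ, ∃ δ : ℝ, 0 < δ ∧ ∀ s t : ℝ≥0, (s : ℝ) ≤ k + 1 → (t : ℝ) ≤ k + 1 →
      dist s t ≤ δ → dist (x s) (x t) ≤ 1 / ((k : ℝ) + 1) := by
    intro k
    have hK : IsCompact (Icc (0 : ℝ≥0) ((k : ℝ≥0) + 1)) := isCompact_Icc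
    have hU := hK.uniformContinuousOn_of_continuous x.continuous.continuousOn
    obtain ⟨δ, hδ, h⟩ := Metric.uniformContinuousOn_iff.1 hU (1 / ((k : ℝ) + 1)) (by positivity)
    refine ⟨δ / 2, half_pos hδ, fun s t hs ht hst ↦ (h s ⟨bot_le, ?_⟩ t ⟨bot_le, ?_⟩
      (hst.trans_lt (half_lt_self hδ))).le⟩
    · exact_mod_cast hs
    · exact_mod_cast ht
  choose δ hδ h using key
  exact ⟨δ, hδ, h⟩

/-- A continuous path starting in `K₀` lies in `Process.modulusSet K₀ δ` for some positive moduli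
`δ`. [folklore] -/
theorem exists_mem_modulusSet {E : Type*} [MetricSpace E] (x : C(ℝ≥0, E)) {K₀ : Set E}
    (h0 : x 0 ∈ K₀) : ∃ δ : ℕ → ℝ, (∀ k, 0 < δ k) ∧ x ∈ Process.modulusSet K₀ δ := by
  obtain ⟨δ, hδ, h⟩ := exists_modulus_of_continuousMap x
  exact ⟨δ, hδ, h0, h⟩

/-- A path escaping to infinity has a transience profile: `‖γ t‖ ≥ j` for `t ≥ T j`. [folklore] -/
theorem exists_transience_profile {γ : ℝ≥0 → ℂ} (h : Tendsto (fun t ↦ ‖γ t‖) atTop atTop) :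
    ∃ T : ℕ → ℝ≥0, ∀ (j : ℕ) (t : ℝ≥0), T j ≤ t → (j : ℝ) ≤ ‖γ t‖ := by
  choose T hT using fun j : ℕ ↦ tendsto_atTop_atTop.1 h (j : ℝ)
  exact ⟨T, hT⟩

/-- **A describable curve class from `a` lies in the image of some box.** If `c` starts at
`a = D.pt 0` and is described through the chordal map `ψ` by a Loewner pair `(γ̂, W)`, then
`W 0 = 0` (`IsLoewnerDescribed.driving_zero`), `γ̂ 0 = 0`, `‖γ̂ t‖ → ∞` (the compactified image
is continuous at `1` and `Ψ ≠ b` on the closed half-plane, `tendsto_norm_atTop_of_tendsto_comp`),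
so `(γ̂, W)` lies in a box and `c = ⟦Ψ ∘ γ̂⟧`. [cite: KemppainenSmirnov2017, §1.2] -/
theorem exists_mem_pairBox_of_isLoewnerDescribable {D : DobrushinDomain}
    {ψ : ConformalEquiv upperHalfPlaneSet D.carrier} (hψ : D.IsChordalUniformizing ψ)
    {c : CurveClass ℂ} (h0 : c.source = D.pt 0) (h : IsLoewnerDescribable ψ c) :
    ∃ (δγ δW : ℕ → ℝ) (T : ℕ → ℝ≥0), (∀ j, 0 < δγ j) ∧ (∀ j, 0 < δW j) ∧
      c ∈ (fun p ↦ compactifiedClass ψ.boundaryExtension (D.pt 1) p.1) ''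
        {p : C(ℝ≥0, ℂ) × C(ℝ≥0, ℝ) | p ∈ generatedPairs ∧
          p.1 ∈ Process.modulusSet ({0} : Set ℂ) δγ ∧ p.2 ∈ Process.modulusSet ({0} : Set ℝ) δW ∧
          ∀ (j : ℕ) (t : ℝ≥0), T j ≤ t → (j : ℝ) ≤ ‖p.1 t‖} := by
  obtain ⟨W, hW⟩ := h
  obtain ⟨hWc, γ, hgen, c', rfl, hI⟩ := id hW
  have hW0 : W 0 = 0 := hW.driving_zero hψ h0
  have hγ0 : γ 0 = 0 := by rw [hgen.2.1, hW0, Complex.ofReal_zero]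
  have hA : ∀ t, γ t ∈ {z : ℂ | 0 ≤ z.im} := fun t ↦ hgen.2.2.1 t
  have htr : Tendsto (fun t ↦ ‖γ t‖) atTop atTop :=
    tendsto_norm_atTop_of_tendsto_comp (isClosed_le continuous_const Complex.continuous_im)
      (continuousOn_boundaryExtension_im_nonneg ψ) hA
      (fun z hz ↦ boundaryExtension_ne_pt_one hψ (mem_closure_upperHalfPlaneSet_iff.2 hz))
      hI.tendsto_atTop
  set p : C(ℝ≥0, ℂ) × C(ℝ≥0, ℝ) := (⟨γ, hgen.1⟩, ⟨W, hWc⟩) with hp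
  obtain ⟨δγ, hδγ, hγm⟩ := exists_mem_modulusSet p.1 (K₀ := ({0} : Set ℂ))
    (show γ 0 ∈ ({0} : Set ℂ) by rw [hγ0]; exact rfl)
  obtain ⟨δW, hδW, hWm⟩ := exists_mem_modulusSet p.2 (K₀ := ({0} : Set ℝ))
    (show W 0 ∈ ({0} : Set ℝ) by rw [hW0]; exact rfl)
  obtain ⟨T, hT⟩ := exists_transience_profile htr
  exact ⟨δγ, δW, T, hδγ, hδW, p, ⟨hgen, hγm, hWm, hT⟩, hI.compactifiedClass_eq⟩

/-- **Finitely many describable classes lie in the image of ONE box** (boxes are monotone in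
their moduli, `pairBox_mono`; merge by `exists_box_forall_of_eventually`). [folklore] -/
theorem exists_pairBox_forall_lt {D : DobrushinDomain}
    {ψ : ConformalEquiv upperHalfPlaneSet D.carrier} (hψ : D.IsChordalUniformizing ψ)
    (v : ℕ → CurveClass ℂ) (N : ℕ) :
    ∃ (δγ δW : ℕ → ℝ) (T : ℕ → ℝ≥0), (∀ j, 0 < δγ j) ∧ (∀ j, 0 < δW j) ∧
      ∀ k < N, (v k).source = D.pt 0 → IsLoewnerDescribable ψ (v k) →
        v k ∈ (fun p ↦ compactifiedClass ψ.boundaryExtension (D.pt 1) p.1) ''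
          {p : C(ℝ≥0, ℂ) × C(ℝ≥0, ℝ) | p ∈ generatedPairs ∧
            p.1 ∈ Process.modulusSet ({0} : Set ℂ) δγ ∧ p.2 ∈ Process.modulusSet ({0} : Set ℝ) δW ∧
            ∀ (j : ℕ) (t : ℝ≥0), T j ≤ t → (j : ℝ) ≤ ‖p.1 t‖} := by
  classical
  -- `f k s = 1` iff `k < N` indexes a sourced describable class outside the image of `s`
  set f : ℕ → Set (C(ℝ≥0, ℂ) × C(ℝ≥0, ℝ)) → ℝ≥0∞ := fun k s ↦
    if k < N ∧ (v k).source = D.pt 0 ∧ IsLoewnerDescribable ψ (v k) ∧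
      v k ∉ (fun p ↦ compactifiedClass ψ.boundaryExtension (D.pt 1) p.1) '' s then 1 else 0 with hf
  have hfa : ∀ (k : ℕ) {s s' : Set (C(ℝ≥0, ℂ) × C(ℝ≥0, ℝ))}, s ⊆ s' → f k s' ≤ f k s := by
    intro k s s' hss'
    simp only [hf]
    split_ifs with h1 h2
    · exact le_rfl
    · exact absurd ⟨h1.1, h1.2.1, h1.2.2.1, fun hm ↦ h1.2.2.2 (image_mono hss' hm)⟩ h2
    · exact bot_le
    · exact le_rfl
  obtain ⟨a, b, c, ha, hb, habc⟩ := exists_box_forall_of_eventually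
    (fun (a b : ℕ → ℝ) (c : ℕ → ℝ≥0) ↦ {p : C(ℝ≥0, ℂ) × C(ℝ≥0, ℝ) | p ∈ generatedPairs ∧
      p.1 ∈ Process.modulusSet ({0} : Set ℂ) a ∧ p.2 ∈ Process.modulusSet ({0} : Set ℝ) b ∧
      ∀ (j : ℕ) (t : ℝ≥0), c j ≤ t → (j : ℝ) ≤ ‖p.1 t‖})
    (fun h1 h2 h3 ↦ pairBox_mono h1 h2 h3) f hfa (ε := 0) (N := N)
    ⟨fun _ ↦ 1, fun _ ↦ 1, fun _ ↦ 0, fun _ ↦ one_pos, fun _ ↦ one_pos, fun k hk ↦ by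
      simp only [hf]
      rw [if_neg fun h ↦ absurd h.1 (not_lt.2 hk)]⟩
    (fun k ↦ by
      by_cases hk : k < N ∧ (v k).source = D.pt 0 ∧ IsLoewnerDescribable ψ (v k)
      · obtain ⟨a, b, c, ha, hb, hmem⟩ :=
          exists_mem_pairBox_of_isLoewnerDescribable hψ hk.2.1 hk.2.2
        refine ⟨a, b, c, ha, hb, ?_⟩
        simp only [hf]
        rw [if_neg fun h ↦ h.2.2.2 hmem]
      · refine ⟨fun _ ↦ 1, fun _ ↦ 1, fun _ ↦ 0, fun _ ↦ one_pos, fun _ ↦ one_pos, ?_⟩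
        simp only [hf]
        rw [if_neg fun h ↦ hk ⟨h.1, h.2.1, h.2.2.1⟩])
  refine ⟨a, b, c, ha, hb, fun k hk h0 hd ↦ ?_⟩
  by_contra hmem
  have h1 := habc k
  simp only [hf] at h1
  rw [if_pos ⟨hk, h0, hd, hmem⟩] at h1
  exact one_ne_zero (le_zero_iff.1 h1)

/-! ### Per-scale box tightness ⟺ almost sure describability (countable range) -/

/-- **Box tightness of a countable-range random curve class from a.e. describability.** For a
finite measure `μ`, a measurable `X : Ω → CurveClass ℂ` with countable range and values from
`a = D.pt 0`, and a chordal map `ψ` of `(D; a, b)`: if `μ`-a.e. `X ω` is Loewner describable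
through `ψ`, then for every `ε > 0` ONE box carries `X` up to mass `ε`. Proof: enumerate the
range `⊆ {v k}`; the events `{∀ k < N, X ≠ v k}` decrease to `∅` (continuity from above); the
finitely many sourced describable `v k`, `k < N`, lie in one box (`exists_pairBox_forall_lt`).
[folklore] -/
theorem boxTight_of_ae_isLoewnerDescribable {Ω : Type*} [MeasurableSpace Ω] (μ : Measure Ω)
    [IsFiniteMeasure μ] {X : Ω → CurveClass ℂ} (hX : Measurable X) (hcount : (range X).Countable)
    {D : DobrushinDomain} {ψ : ConformalEquiv upperHalfPlaneSet D.carrier}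
    (hψ : D.IsChordalUniformizing ψ) (h0 : ∀ ω, (X ω).source = D.pt 0)
    (hdesc : ∀ᵐ ω ∂μ, IsLoewnerDescribable ψ (X ω)) :
    ∀ ε : ℝ≥0∞, 0 < ε → ∃ (δγ δW : ℕ → ℝ) (T : ℕ → ℝ≥0), (∀ j, 0 < δγ j) ∧ (∀ j, 0 < δW j) ∧
      μ (X ⁻¹' ((fun p ↦ compactifiedClass ψ.boundaryExtension (D.pt 1) p.1) ''
        {p : C(ℝ≥0, ℂ) × C(ℝ≥0, ℝ) | p ∈ generatedPairs ∧
          p.1 ∈ Process.modulusSet ({0} : Set ℂ) δγ ∧ p.2 ∈ Process.modulusSet ({0} : Set ℝ) δW ∧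
          ∀ (j : ℕ) (t : ℝ≥0), T j ≤ t → (j : ℝ) ≤ ‖p.1 t‖})ᶜ) ≤ ε := by
  classical
  intro ε hε
  haveI : Nonempty (CurveClass ℂ) := ⟨CurveClass.mk (Curve.const 0)⟩
  obtain ⟨v, hv⟩ := Set.countable_iff_exists_subset_range.1 hcount
  -- the events "`X` is none of the first `N` values" decrease to `∅`
  set B : ℕ → Set Ω := fun N ↦ {ω | ∀ k < N, X ω ≠ v k} with hB
  have hBmeas : ∀ N, MeasurableSet (B N) := fun N ↦ by
    rw [show B N = ⋂ k ∈ Finset.range N, (X ⁻¹' {v k})ᶜ by ext ω; simp [hB]]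
    exact Finset.measurableSet_biInter _ fun k _ ↦ (hX (measurableSet_singleton _)).compl
  have hBanti : Antitone B := fun N N' hNN' ω hω k hk ↦ hω k (hk.trans_le hNN')
  have hBempty : ⋂ N, B N = ∅ := by
    ext ω
    simp only [mem_iInter, mem_empty_iff_false, iff_false]
    intro hω
    obtain ⟨k, hk⟩ := hv ⟨ω, rfl⟩
    exact hω (k + 1) k (Nat.lt_succ_self k) hk.symm
  have htend : Tendsto (μ ∘ B) atTop (𝓝 0) := by
    simpa only [hBempty, measure_empty] using tendsto_measure_iInter_atTop (μ := μ)
      (fun N ↦ (hBmeas N).nullMeasurableSet) hBanti ⟨0, measure_ne_top μ _⟩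
  obtain ⟨N, hN⟩ := ENNReal.tendsto_atTop_zero.1 htend ε hε
  obtain ⟨δγ, δW, T, hδγ, hδW, hbox⟩ := exists_pairBox_forall_lt hψ v N
  have hnull : μ {ω | ¬ IsLoewnerDescribable ψ (X ω)} = 0 := ae_iff.1 hdesc
  refine ⟨δγ, δW, T, hδγ, hδW, (measure_mono (show _ ⊆ B N ∪ {ω | ¬ IsLoewnerDescribable ψ (X ω)}
    from fun ω hω ↦ ?_)).trans ((measure_union_le _ _).trans ?_)⟩
  · rw [mem_preimage, mem_compl_iff] at hω
    by_cases hd : IsLoewnerDescribable ψ (X ω)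
    · refine Or.inl fun k hk heq ↦ hω ?_
      rw [heq]
      exact hbox k hk (heq ▸ h0 ω) (heq ▸ hd)
    · exact Or.inr hd
  · rw [hnull, add_zero]; exact hN N le_rfl

/-- **The converse: box tightness forces a.e. describability** (a box pair is a transient Loewner
pair, hence describes the class of its compactified image, `isLoewnerDescribed_compactifiedClass`).
So per-scale box tightness and a.e. describability are equivalent for countable-range maps.
[cite: KemppainenSmirnov2017, §1.2] -/
theorem ae_isLoewnerDescribable_of_boxTight {Ω : Type*} [MeasurableSpace Ω] (μ : Measure Ω)
    {X : Ω → CurveClass ℂ} {D : DobrushinDomain} {ψ : ConformalEquiv upperHalfPlaneSet D.carrier}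
    (hψ : D.IsChordalUniformizing ψ)
    (h : ∀ ε : ℝ≥0∞, 0 < ε → ∃ (δγ δW : ℕ → ℝ) (T : ℕ → ℝ≥0), (∀ j, 0 < δγ j) ∧
      (∀ j, 0 < δW j) ∧
      μ (X ⁻¹' ((fun p ↦ compactifiedClass ψ.boundaryExtension (D.pt 1) p.1) ''
        {p : C(ℝ≥0, ℂ) × C(ℝ≥0, ℝ) | p ∈ generatedPairs ∧
          p.1 ∈ Process.modulusSet ({0} : Set ℂ) δγ ∧ p.2 ∈ Process.modulusSet ({0} : Set ℝ) δW ∧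
          ∀ (j : ℕ) (t : ℝ≥0), T j ≤ t → (j : ℝ) ≤ ‖p.1 t‖})ᶜ) ≤ ε) :
    ∀ᵐ ω ∂μ, IsLoewnerDescribable ψ (X ω) := by
  rw [ae_iff]
  refine le_antisymm (ENNReal.le_of_forall_pos_le_add fun ε hε _ ↦ ?_) bot_le
  obtain ⟨δγ, δW, T, -, -, hμ⟩ := h ε (by exact_mod_cast hε)
  rw [zero_add]
  refine (measure_mono fun ω hω ↦ ?_).trans hμ
  rw [mem_preimage, mem_compl_iff]
  rintro ⟨p, hp, hpX⟩
  refine absurd ?_ hω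
  rw [← hpX]
  refine (isLoewnerDescribed_compactifiedClass hψ hp.1
    (tendsto_atTop_atTop.2 fun r ↦ ?_)).isLoewnerDescribable
  obtain ⟨j, hj⟩ := exists_nat_ge r
  exact ⟨T j, fun t ht ↦ hj.trans (hp.2.2.2 j t ht)⟩

/-! ### The bond-`ℤ²` interface at a fixed admissible mesh -/

/-- **Per-scale box tightness of the raw interface (hypothesis `hfin` of
`percFaceBoxTight_of_conditionG2_of_transfer`, verbatim) from a.e. Loewner describability at each
fixed positive admissible mesh.** The interface depends on `ω` only through the medial
exploration, so it has countable range (`countable_range_of_medialExploration`) and is measurable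
(`measurable_bondInterfaceIn`); it starts at `pt 0` of the oriented face domain
(`exists_curve_bondInterfaceIn`); apply `boxTight_of_ae_isLoewnerDescribable`.
[cite: KemppainenSmirnov2017, §1.2 and §4.1.4] -/
theorem percBoxTightFixedMesh_of_ae_isLoewnerDescribable
    (hdesc : ∀ (D : DobrushinDomain) (Λ : ℝ → DiscreteDobrushin) (hΛ : ZdDiscretisationFamily D Λ)
      (δ : ℝ), 0 < δ → ∀ (hadm : (Λ δ).IsZdAdmissible)
        (ψ : ConformalEquiv upperHalfPlaneSet (orientedFaceDomain hΛ hadm).carrier),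
        (orientedFaceDomain hΛ hadm).IsChordalUniformizing ψ →
        ∀ᵐ ω ∂Pc, IsLoewnerDescribable ψ (bondInterfaceIn D (Λ δ) ω)) :
    ∀ (D : DobrushinDomain) (Λ : ℝ → DiscreteDobrushin) (hΛ : ZdDiscretisationFamily D Λ)
      (δ : ℝ), 0 < δ → ∀ (hadm : (Λ δ).IsZdAdmissible)
        (ψ : ConformalEquiv upperHalfPlaneSet (orientedFaceDomain hΛ hadm).carrier),
        (orientedFaceDomain hΛ hadm).IsChordalUniformizing ψ →
        ∀ ε : ℝ≥0∞, 0 < ε → ∃ (δγ δW : ℕ → ℝ) (T : ℕ → ℝ≥0), (∀ j, 0 < δγ j) ∧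
          (∀ j, 0 < δW j) ∧
          Pc ((bondInterfaceIn D (Λ δ)) ⁻¹'
            ((fun p ↦ compactifiedClass ψ.boundaryExtension
                ((orientedFaceDomain hΛ hadm).pt 1) p.1) ''
              {p : C(ℝ≥0, ℂ) × C(ℝ≥0, ℝ) | p ∈ generatedPairs ∧
                p.1 ∈ Process.modulusSet ({0} : Set ℂ) δγ ∧
                p.2 ∈ Process.modulusSet ({0} : Set ℝ) δW ∧
                ∀ (j : ℕ) (t : ℝ≥0), T j ≤ t → (j : ℝ) ≤ ‖p.1 t‖})ᶜ) ≤ ε := by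
  intro D Λ hΛ δ hδ hadm ψ hψ
  refine boxTight_of_ae_isLoewnerDescribable Pc (measurable_bondInterfaceIn D (Λ δ))
    (countable_range_of_medialExploration (Λ δ) fun ω ω' h ↦ by
      rw [bondInterfaceIn_apply, bondInterfaceIn_apply, medialExplorationCurve_congr h])
    hψ (fun ω ↦ ?_) (hdesc D Λ hΛ δ hδ hadm ψ hψ)
  obtain ⟨c, hc, hc0, -, -⟩ := exists_curve_bondInterfaceIn hΛ hadm ω
  rw [← hc, CurveClass.source_mk]
  exact hc0

/-- **`PercFaceBoxTight` from Kemppainen–Smirnov's theorem, a simple modification with Condition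
G2, the eventual transfer, and a.e. Loewner describability of the raw polyline at each fixed
mesh** — `percFaceBoxTight_of_conditionG2_of_modification` (p152755) with its per-scale box
tightness hypothesis `hfin` replaced by the box-free (iv′) `hdesc`; the other hypotheses (`hKS` =
the named fact `exists_regularity_of_conditionG2`; `γm`, `hmeas`, `hsupp`, `hG2` = KS17 §4.1.2
modification with ONE Condition G2 from RSW, Prop. 4.3 / 4.7; `htr` = the eventual pathwise
transfer with slack) are unchanged and documented there.
[cite: KemppainenSmirnov2017, Prop. 3.2, Thm. 3.9, Thm. 3.10, §4.1.2 and Prop. 4.7] -/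
theorem percFaceBoxTight_of_conditionG2_of_describable
    (hKS : exists_regularity_of_conditionG2)
    (γm : ∀ ⦃D : DobrushinDomain⦄ ⦃Λ : ℝ → DiscreteDobrushin⦄, ZdDiscretisationFamily D Λ →
      ∀ ⦃δ : ℝ⦄, (Λ δ).IsZdAdmissible → BondConfig (Site 2) → CurveClass ℂ)
    (hmeas : ∀ (D : DobrushinDomain) (Λ : ℝ → DiscreteDobrushin) (hΛ : ZdDiscretisationFamily D Λ)
      (δ : ℝ) (hadm : (Λ δ).IsZdAdmissible), 0 < δ →
      Measurable (γm hΛ hadm) ∧ MeasurableSet (range (γm hΛ hadm)))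
    (hsupp : ∀ (D : DobrushinDomain) (Λ : ℝ → DiscreteDobrushin) (hΛ : ZdDiscretisationFamily D Λ)
      (δ : ℝ) (hadm : (Λ δ).IsZdAdmissible)
      (ψ : ConformalEquiv upperHalfPlaneSet (orientedFaceDomain hΛ hadm).carrier),
      (orientedFaceDomain hΛ hadm).IsChordalUniformizing ψ → 0 < δ →
      ∀ ω, ∃ c : Curve ℂ, CurveClass.mk c = γm hΛ hadm ω ∧
        c 0 = (orientedFaceDomain hΛ hadm).pt 0 ∧ c 1 = (orientedFaceDomain hΛ hadm).pt 1 ∧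
        (∀ s : I, 0 < (s : ℝ) → (s : ℝ) < 1 → c s ∈ (orientedFaceDomain hΛ hadm).carrier) ∧
        InjOn c {s : I | 0 < (s : ℝ) ∧ (s : ℝ) < 1} ∧
        Tendsto (fun u : ℝ ↦ (ψ.symm (IccExtend zero_le_one c u)).im) (𝓝[<] 1) atTop)
    (hG2 : ConditionG2 {L : MarkedLaw | ∃ (D : DobrushinDomain) (Λ : ℝ → DiscreteDobrushin)
      (hΛ : ZdDiscretisationFamily D Λ) (δ : ℝ) (hadm : (Λ δ).IsZdAdmissible), 0 < δ ∧
      L = ⟨(orientedFaceDomain hΛ hadm).carrier, (orientedFaceDomain hΛ hadm).pt 0,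
        (orientedFaceDomain hΛ hadm).pt 1, Pc.map (γm hΛ hadm)⟩})
    (htr : ∀ (D : DobrushinDomain) (Λ : ℝ → DiscreteDobrushin) (hΛ : ZdDiscretisationFamily D Λ)
      (φ : ConformalEquiv upperHalfPlaneSet D.carrier), D.IsChordalUniformizing φ →
      ∀ (δs : ℕ → ℝ), (∀ k, 0 < δs k) → Tendsto δs atTop (𝓝 0) →
      ∀ (hadm : ∀ k, (Λ (δs k)).IsZdAdmissible)
        (φs : ∀ k, ConformalEquiv upperHalfPlaneSet (orientedFaceDomain hΛ (hadm k)).carrier),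
        (∀ k, (orientedFaceDomain hΛ (hadm k)).IsChordalUniformizing (φs k)) →
        (∀ R : ℝ, TendstoUniformlyOn (fun k ↦ (φs k).boundaryExtension) φ.boundaryExtension
          atTop ({z : ℂ | 0 ≤ z.im} ∩ closedBall 0 R)) →
        (∀ ε : ℝ, 0 < ε → ∃ r : ℝ, ∀ᶠ k in atTop, ∀ z : ℂ, z ∈ {z : ℂ | 0 ≤ z.im} → r ≤ ‖z‖ →
          dist ((φs k).boundaryExtension z) ((orientedFaceDomain hΛ (hadm k)).pt 1) ≤ ε) →
        ∀ (δγ δW : ℕ → ℝ) (T : ℕ → ℝ≥0), (∀ j, 0 < δγ j) → (∀ j, 0 < δW j) →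
          ∀ ε : ℝ≥0∞, 0 < ε → ∃ (δγ' δW' : ℕ → ℝ) (T' : ℕ → ℝ≥0), (∀ j, 0 < δγ' j) ∧
            (∀ j, 0 < δW' j) ∧
            ∀ᶠ k in atTop, Pc {ω | γm hΛ (hadm k) ω ∈
                (fun p ↦ compactifiedClass (φs k).boundaryExtension
                    ((orientedFaceDomain hΛ (hadm k)).pt 1) p.1) ''
                  {p : C(ℝ≥0, ℂ) × C(ℝ≥0, ℝ) | p ∈ generatedPairs ∧
                    p.1 ∈ Process.modulusSet ({0} : Set ℂ) δγ ∧
                    p.2 ∈ Process.modulusSet ({0} : Set ℝ) δW ∧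
                    ∀ (j : ℕ) (t : ℝ≥0), T j ≤ t → (j : ℝ) ≤ ‖p.1 t‖} ∧
              bondInterfaceIn D (Λ (δs k)) ω ∉
                (fun p ↦ compactifiedClass (φs k).boundaryExtension
                    ((orientedFaceDomain hΛ (hadm k)).pt 1) p.1) ''
                  {p : C(ℝ≥0, ℂ) × C(ℝ≥0, ℝ) | p ∈ generatedPairs ∧
                    p.1 ∈ Process.modulusSet ({0} : Set ℂ) δγ' ∧
                    p.2 ∈ Process.modulusSet ({0} : Set ℝ) δW' ∧
                    ∀ (j : ℕ) (t : ℝ≥0), T' j ≤ t → (j : ℝ) ≤ ‖p.1 t‖}} ≤ ε)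
    (hdesc : ∀ (D : DobrushinDomain) (Λ : ℝ → DiscreteDobrushin) (hΛ : ZdDiscretisationFamily D Λ)
      (δ : ℝ), 0 < δ → ∀ (hadm : (Λ δ).IsZdAdmissible)
        (ψ : ConformalEquiv upperHalfPlaneSet (orientedFaceDomain hΛ hadm).carrier),
        (orientedFaceDomain hΛ hadm).IsChordalUniformizing ψ →
        ∀ᵐ ω ∂Pc, IsLoewnerDescribable ψ (bondInterfaceIn D (Λ δ) ω)) :
    PercFaceBoxTight :=
  percFaceBoxTight_of_conditionG2_of_modification hKS γm hmeas hsupp hG2 htr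
    (percBoxTightFixedMesh_of_ae_isLoewnerDescribable hdesc)

/-- **Raw describability is necessary for the stub**: `PercFaceBoxTight` implies that along every
system of its data (family, chordal `φ`, positive admissible meshes `δ_k → 0`, chordal maps `φ_k`
of the oriented face domains with (U1), (U2)), at EVERY scale `k`, `Pc`-a.e. the raw interface
`bondInterfaceIn D (Λ δ_k)` is Loewner describable through `φ_k`
(`ae_isLoewnerDescribable_of_boxTight`). [cite: KemppainenSmirnov2017, §1.2] -/
theorem ae_isLoewnerDescribable_of_percFaceBoxTight : PercFaceBoxTight →
    ∀ (D : DobrushinDomain) (Λ : ℝ → DiscreteDobrushin) (hΛ : ZdDiscretisationFamily D Λ)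
      (φ : ConformalEquiv upperHalfPlaneSet D.carrier), D.IsChordalUniformizing φ →
    ∀ (δs : ℕ → ℝ), (∀ k, 0 < δs k) → Tendsto δs atTop (𝓝 0) →
    ∀ (hadm : ∀ k, (Λ (δs k)).IsZdAdmissible)
      (φs : ∀ k, ConformalEquiv upperHalfPlaneSet (orientedFaceDomain hΛ (hadm k)).carrier),
      (∀ k, (orientedFaceDomain hΛ (hadm k)).IsChordalUniformizing (φs k)) →
      (∀ R : ℝ, TendstoUniformlyOn (fun k ↦ (φs k).boundaryExtension) φ.boundaryExtension
        atTop ({z : ℂ | 0 ≤ z.im} ∩ closedBall 0 R)) →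
      (∀ ε : ℝ, 0 < ε → ∃ r : ℝ, ∀ᶠ k in atTop, ∀ z : ℂ, z ∈ {z : ℂ | 0 ≤ z.im} → r ≤ ‖z‖ →
        dist ((φs k).boundaryExtension z) ((orientedFaceDomain hΛ (hadm k)).pt 1) ≤ ε) →
    ∀ k : ℕ, ∀ᵐ ω ∂Pc, IsLoewnerDescribable (φs k) (bondInterfaceIn D (Λ (δs k)) ω) := by
  intro hBT D Λ hΛ φ hφ δs hpos hlim hadm φs hφs hU1 hU2 k
  exact ae_isLoewnerDescribable_of_boxTight Pc (hφs k) fun ε hε ↦ by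
    obtain ⟨δγ, δW, T, hδγ, hδW, h⟩ := hBT D Λ hΛ φ hφ δs hpos hlim hadm φs hφs hU1 hU2 ε hε
    exact ⟨δγ, δW, T, hδγ, hδW, h k⟩
end Summit.CriticalPhenomena.CardyFormulaZ2.Cruxes.MartingaleToSLE6.Birth

end
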